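import Mathlib
import HarnessLib
import Literature.Computability.MetaComplexity.MCSP
import Literature.Computability.MetaComplexity.TruthTablesProofs
import Literature.Computability.Learning.SizeClassCounting
import Literature.Computability.Complexity.HiraharaTable

/-!
# Counting the mixed words (`stub_mixed_count`)

Route `UniformStream`, crux `UniformStreamLB` (stmt-PneNP-16045), line `birth`, calibration from
below (levels `c ≤ 1` of the crux matrix for the size bound `s = id`): the registered stub
`stub_mixed_count` (`--supports stmt-PneNP-16045`), the counting half of the block-product fooling
argument against one-pass streaming deciders of `MCSP[n ↦ n]` with `⌊log₂ N⌋ + 1` state bits.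

**Theorem (`stub_mixed_count`).** Let `T` be a finite set of bit strings of length `2^m` such that
every *mixed word* — the concatenation of `2^j` blocks drawn from `T`, a string of length
`2^j · 2^m = 2^(m+j)` — lies in `MCSP[n ↦ n]`. Then `|T|^(2^j) ≤ (2(m+j)+2)^(7(m+j)+2)`.

*Proof.* The mixed word of `f : [2^j] → T` has length `2^(m+j)`, so its membership in `MCSP[n ↦ n]`
says it is the truth table of an `(m+j)`-variable Boolean function `F_f` of `B₂`-circuit complexity
`≤ m + j` (a truth table of length `2ⁿ` determines `n`; `MixedCount.exists_fn_of_mem`). A minimum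
circuit of `F_f` (`exists_computes_B2_size_eq_holds`) has at most `m + j` gates, hence a code in the
finite type `Learning.CircuitCode (m+j) (m+j)` (`Learning.circuitCodeOf`) decoding to `F_f`
(`Learning.toFun_circuitCodeOf`; `MixedCount.exists_code_of_size_le`), and there are at most
`((m+j) + (m+j) + 2)^(7(m+j)+2)` such codes (`HiraharaRed.card_circuitCode_le_pow`, the circuit count
of Arora–Barak 2009, Thm. 6.21). The assignment `f ↦ code(F_f)` is injective: equal codes decode to
equal functions, hence to equal truth tables, i.e. equal mixed words, and concatenation of `2^j`
blocks of the common length `2^m` is injective (`MixedCount.flatten_injective_of_length`,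
`MixedCount.ofFn_val_injective`). Therefore `|T|^(2^j) = #(Fin (2^j) → T) ≤ #CircuitCode (m+j) (m+j)`.

## References

* S. Arora, B. Barak, *Computational Complexity: A Modern Approach*, CUP 2009, Thm. 6.21 (proof,
  p. 116: at most `(n + s + 2)^{O(s)}` circuits of size `s`, counted by adjacency-list codes).
  [AroraBarakCC2009]
* V. Kabanets, J.-Y. Cai, *Circuit minimization problem*, STOC 2000, §2 (`MCSP[s]`). [KabanetsCai2000]
-/

noncomputable section

namespace Summit.PneNP.PneNP.Theorems.UniformStreamLB.Birth

open Literature.Computability.Complexity Literature.Computability.MetaComplexity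
open Literature.Computability.Learning (CircuitCode circuitCodeOf toFun_circuitCodeOf)

namespace MixedCount

/-- Concatenation of blocks of a common length `ℓ` is injective on block lists with the same number
of blocks. [folklore] -/
theorem flatten_injective_of_length {α : Type*} {ℓ : ℕ} :
    ∀ {ws ws' : List (List α)}, (∀ w ∈ ws, w.length = ℓ) → (∀ w ∈ ws', w.length = ℓ) →
      ws.length = ws'.length → ws.flatten = ws'.flatten → ws = ws'
  | [], [], _, _, _, _ => rfl
  | [], _ :: _, _, _, h, _ => absurd h (by simp)
  | _ :: _, [], _, _, h, _ => absurd h (by simp)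
  | w :: ws, w' :: ws', hws, hws', hlen, hflat => by
    rw [List.flatten_cons, List.flatten_cons] at hflat
    have hw : w.length = w'.length := by
      rw [hws w List.mem_cons_self, hws' w' List.mem_cons_self]
    obtain ⟨rfl, htail⟩ := List.append_inj hflat hw
    rw [flatten_injective_of_length (fun x hx => hws x (List.mem_cons_of_mem w hx))
      (fun x hx => hws' x (List.mem_cons_of_mem w hx)) (by simpa using hlen) htail]

/-- A mixed word of `2^j` blocks of length `2^m` has length `2^(m+j)`. [folklore] -/
theorem length_flatten_ofFn {m j : ℕ} {T : Finset (List Bool)} (hT : ∀ w ∈ T, w.length = 2 ^ m)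
    (f : Fin (2 ^ j) → T) :
    (List.ofFn fun i => (f i : List Bool)).flatten.length = 2 ^ (m + j) := by
  rw [List.length_flatten, List.map_ofFn, List.sum_ofFn]
  calc ∑ i, (List.length ∘ fun i => (f i : List Bool)) i = ∑ _i : Fin (2 ^ j), 2 ^ m :=
        Finset.sum_congr rfl fun i _ => hT _ (f i).2
    _ = 2 ^ (m + j) := by
        rw [Finset.sum_const, Finset.card_univ, Fintype.card_fin, smul_eq_mul]
        ring

/-- A mixed word determines its sequence of blocks (all blocks have the same length `2^m`).
[folklore] -/
theorem ofFn_val_injective {m j : ℕ} {T : Finset (List Bool)} (hT : ∀ w ∈ T, w.length = 2 ^ m) :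
    Function.Injective fun f : Fin (2 ^ j) → T => (List.ofFn fun i => (f i : List Bool)).flatten := by
  intro f f' h
  have hblk : ∀ g : Fin (2 ^ j) → T, ∀ w ∈ List.ofFn (fun i => (g i : List Bool)),
      w.length = 2 ^ m := by
    intro g w hw
    obtain ⟨i, rfl⟩ := List.mem_ofFn.1 hw
    exact hT _ (g i).2
  have hof := flatten_injective_of_length (hblk f) (hblk f') (by simp) h
  funext i
  exact Subtype.ext (congrFun (List.ofFn_injective hof) i)

/-- A mixed word lying in `MCSP[n ↦ n]` is the truth table of an `(m+j)`-variable function of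
`B₂`-circuit complexity `≤ m + j`: the length `2^(m+j)` of the word fixes the arity.
[cite: KabanetsCai2000, §2] -/
theorem exists_fn_of_mem {m j : ℕ} {T : Finset (List Bool)} (hT : ∀ w ∈ T, w.length = 2 ^ m)
    (f : Fin (2 ^ j) → T)
    (hmem : (List.ofFn fun i => (f i : List Bool)).flatten ∈ MCSPSize fun n => n) :
    ∃ F : (Fin (m + j) → Bool) → Bool,
      truthTable F = (List.ofFn fun i => (f i : List Bool)).flatten ∧
        circuitSizeOver B2 F ≤ m + j := by
  obtain ⟨n, F, hw, hF⟩ := hmem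
  have hlen := length_flatten_ofFn hT f
  rw [hw, length_truthTable] at hlen
  obtain rfl : n = m + j := Nat.pow_right_injective le_rfl hlen
  exact ⟨F, hw.symm, hF⟩

/-- A function of `B₂`-circuit complexity `≤ n` on `n` variables is the decoding of a code of a
circuit with `≤ n` gates (a minimum circuit exists and has a code).
[cite: AroraBarakCC2009, Thm. 6.21 (proof, p. 116)] -/
theorem exists_code_of_size_le {n : ℕ} (F : (Fin n → Bool) → Bool)
    (hF : circuitSizeOver B2 F ≤ n) :
    ∃ c : CircuitCode n n, c.toFun = F := by
  obtain ⟨C, hC, hCF, hsize⟩ := exists_computes_B2_size_eq_holds F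
  refine ⟨circuitCodeOf C hC (hsize.trans_le hF), ?_⟩
  rw [toFun_circuitCodeOf]
  funext x
  exact hCF x

end MixedCount

/-- **Stub LOW-C (counting the mixed words).** If every mixed word of `2^j` blocks from `T` (blocks of
length `2^m`) lies in `MCSP[n ↦ n]`, then `|T|^{2^j}` is at most the number of `(m+j)`-variable functions of
circuit complexity `≤ m + j`, hence `≤ (2(m+j)+2)^{7(m+j)+2}` (the tree's circuit-code count
`HiraharaRed.card_circuitCode_le_pow`). [cite: AroraBarakCC2009, Thm. 6.21 (proof, p. 116)] -/
theorem stub_mixed_count (m j : ℕ) (T : Finset (List Bool)) (hT : ∀ w ∈ T, w.length = 2 ^ m)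
    (hmix : ∀ f : Fin (2 ^ j) → List Bool, (∀ i, f i ∈ T) →
      (List.ofFn f).flatten ∈ MCSPSize fun n => n) :
    T.card ^ (2 ^ j) ≤ (2 * (m + j) + 2) ^ (7 * (m + j) + 2) := by
  -- the `(m+j)`-variable function tabulated by each mixed word, of circuit complexity `≤ m + j`
  have hF : ∀ f : Fin (2 ^ j) → T, ∃ F : (Fin (m + j) → Bool) → Bool,
      truthTable F = (List.ofFn fun i => (f i : List Bool)).flatten ∧
        circuitSizeOver B2 F ≤ m + j := fun f =>
    MixedCount.exists_fn_of_mem hT f (hmix (fun i => (f i : List Bool)) fun i => (f i).2)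
  choose F hFtt hFsize using hF
  -- the code of a minimum circuit of that function
  have hc : ∀ f : Fin (2 ^ j) → T, ∃ c : CircuitCode (m + j) (m + j), c.toFun = F f :=
    fun f => MixedCount.exists_code_of_size_le (F f) (hFsize f)
  choose Φ hΦ using hc
  -- `f ↦ Φ f` is injective: codes decode to functions, functions have truth tables = mixed words
  have hinj : Function.Injective Φ := by
    intro f f' h
    have hFF : F f = F f' := by rw [← hΦ f, ← hΦ f', h]
    apply MixedCount.ofFn_val_injective hT
    change (List.ofFn fun i => (f i : List Bool)).flatten =
      (List.ofFn fun i => (f' i : List Bool)).flatten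
    rw [← hFtt f, ← hFtt f', hFF]
  calc T.card ^ 2 ^ j = Fintype.card (Fin (2 ^ j) → T) := by
        rw [Fintype.card_fun, Fintype.card_coe, Fintype.card_fin]
    _ ≤ Fintype.card (CircuitCode (m + j) (m + j)) := Fintype.card_le_of_injective Φ hinj
    _ ≤ (m + j + (m + j) + 2) ^ (7 * (m + j) + 2) := HiraharaRed.card_circuitCode_le_pow _ _
    _ = (2 * (m + j) + 2) ^ (7 * (m + j) + 2) := by rw [two_mul]

end Summit.PneNP.PneNP.Theorems.UniformStreamLB.Birth

end
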